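import Mathlib.Analysis.SpecialFunctions.Pow.Real
import Mathlib.NumberTheory.SiegelsLemma
import Literature.NumberTheory.Transcendental.SchneiderCuspCounting
import Literature.NumberTheory.Transcendental.SchneiderCuspExtrapolation
import HarnessLib

/-!
# The extrapolation engine of Schneider's method at a cusp

The induction over integer points in the proof of
`Literature.NumberTheory.Transcendental.frequently_card_le_mul_log` (file `SchneiderCuspGerm`),
isolated with an abstract interface: a function `F` holomorphic on `|z| < r₁` with `|F| ≤ B` on
`|z| = ρ`, an increasing unbounded ray `w : ℕ → ℝ` (`w N = N^{1/e}` in the application) with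
sample points `σ_N = (w N)⁻¹`, a predicate `hit` with integer values `V N` such that
`F(σ_N) = σ_N^T V_N` at hits `N > Y₀`, a set `E` of `m = 32 s² k²` hits in `(Y₀, Y₀^k]` where
`V` vanishes (Siegel's lemma), the near-record-low inequality
`n₀ log w(X) < 2 #{hits ≤ X} log w(Y₀)` for `X ≥ Y₀` (`n₀ = #{hits ≤ Y₀} ≥ 128 s² k`,
`k ≥ 16`), and the size conditions `log w(Y₀) ≥ 2 log(2/ρ) + lC + 2`,
`log B = 4 log D + 2 D lC + k T log w(Y₀)` (`D = 8 s k`, `T = 8 s² k`). Conclusion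
(`cusp_hits_vanish`): `V K = 0` at every hit `K > Y₀` — by strong induction, each step being
the crude Schwarz lemma `norm_le_at_sample` followed by `phase_one_neg` (`K ≤ Y₀^k`, zeros `E`)
or `phase_two_neg` (`K > Y₀^k`, zeros = all hits in `(Y₀, K)`), and the arithmetic kill
`int_eq_zero_of_abs_le`. Also: the zeros then accumulate at the centre
(`frequently_eq_zero_of_hits`), and the Siegel step producing the integer coefficients
`a ∈ ℤ^{D×D} ∖ 0` with `∑ a_{ij} Nⁱ L_Nʲ = 0` on `E` and `|a| ≤ D² C₀^D u^T`
(`exists_cuspAux_coeffs`, Mathlib's `Int.Matrix.exists_ne_zero_int_vec_norm_le`).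

## References

* [folklore] Th. Schneider, *Math. Ann.* 121 (1949) 131–140; M. Waldschmidt, *Acta Math. Acad.
  Sci. Hungar.* 31 (1978) 21–25 (Pólya's theorem by Schneider's method).
-/

noncomputable section

open Filter Metric Finset
open scoped Topology

namespace Literature.NumberTheory.Transcendental

/-- **The extrapolation engine** (see the module docstring for the interface): under the listed
hypotheses every hit `K > Y₀` satisfies `V K = 0`. [folklore] -/
theorem cusp_hits_vanish {F : ℂ → ℂ} {r₁ ρ B : ℝ} (hρ : 0 < ρ) (hρr : ρ < r₁) (hρ1 : ρ ≤ 1)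
    (hF : DifferentiableOn ℂ F (ball 0 r₁)) (hB : ∀ z ∈ sphere (0 : ℂ) ρ, ‖F z‖ ≤ B)
    (hB0 : 0 < B) (w : ℕ → ℝ) (hw_pos : ∀ N, 0 < N → 0 < w N)
    (hw_mono : ∀ N N', N ≤ N' → w N ≤ w N') (hw_inj : Function.Injective w)
    (hw_two : ∀ K, 2 ≤ K → w K ≤ 2 * w (K - 1)) {Y₀ k : ℕ} (hY₀ : 0 < Y₀)
    (hwY : w (Y₀ ^ k) = w Y₀ ^ k) (hu₀ : 2 / ρ ≤ w Y₀) (hit : ℕ → Prop) [DecidablePred hit]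
    (V : ℕ → ℤ) {T : ℕ}
    (hFval : ∀ N, Y₀ < N → hit N →
      F (((w N)⁻¹ : ℝ) : ℂ) = (((w N)⁻¹ : ℝ) : ℂ) ^ T * (V N : ℂ))
    (E : Finset ℕ) (hEmem : ∀ N ∈ E, Y₀ < N ∧ N ≤ Y₀ ^ k ∧ hit N) (hEzero : ∀ N ∈ E, V N = 0)
    {n₀ : ℕ} (hn₀ : ((Iic Y₀).filter hit).card = n₀)
    (hrec : ∀ X, Y₀ ≤ X →
      (n₀ : ℝ) * Real.log (w X) < 2 * ((Iic X).filter hit).card * Real.log (w Y₀))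
    {s₀ : ℕ} {lC : ℝ} (hs₀ : 1 ≤ s₀) (hk : 16 ≤ k) (hn₀k : 128 * s₀ ^ 2 * k ≤ n₀)
    (hEcard : E.card = 32 * s₀ ^ 2 * k ^ 2) (hT : T = 8 * s₀ ^ 2 * k) (hlC : 0 ≤ lC)
    (hlam : 2 * Real.log (2 / ρ) + lC + 2 ≤ Real.log (w Y₀))
    (hlogB : Real.log B = 4 * Real.log (8 * s₀ * k : ℝ) + 2 * (8 * s₀ * k : ℝ) * lC +
      k * T * Real.log (w Y₀)) :
    ∀ K, Y₀ < K → hit K → V K = 0 := by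
  /- notation and elementary facts -/
  set u₀ : ℝ := w Y₀ with hu₀_def
  set lam : ℝ := Real.log u₀ with hlam_def
  set lρ : ℝ := Real.log (2 / ρ) with hlρ_def
  set cnt : ℕ → ℕ := fun X => ((Iic X).filter hit).card with hcnt_def
  have hu₀pos : 0 < u₀ := hw_pos Y₀ hY₀
  have h2ρ : 2 ≤ 2 / ρ := by
    rw [le_div_iff₀ hρ]; linarith
  have hlρ0 : 0 ≤ lρ := Real.log_nonneg (by linarith)
  have hlam_pos : 0 < lam := by
    have : 2 * lρ + lC + 2 ≤ lam := hlam
    linarith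
  have hu₀1 : 1 ≤ u₀ := by linarith
  have hs₀R : (1 : ℝ) ≤ s₀ := by exact_mod_cast hs₀
  have hk16R : (16 : ℝ) ≤ k := by exact_mod_cast hk
  have hk1 : 1 ≤ k := le_trans (by norm_num) hk
  have hk1R : (1 : ℝ) ≤ k := by exact_mod_cast hk1
  have hn₀kR : (128 : ℝ) * s₀ ^ 2 * k ≤ n₀ := by exact_mod_cast hn₀k
  have hDpos : (0 : ℝ) < 8 * s₀ * k := by positivity
  have hTR : (T : ℝ) = 8 * s₀ ^ 2 * k := by rw [hT]; push_cast; ring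
  have hw_nonneg : ∀ N, 0 < N → 0 ≤ w N := fun N hN => (hw_pos N hN).le
  -- sample points
  have hσpos : ∀ N, Y₀ < N → 0 < (w N)⁻¹ := fun N hN => inv_pos.mpr (hw_pos N (by omega))
  have hσle : ∀ N, Y₀ < N → (w N)⁻¹ ≤ u₀⁻¹ := fun N hN =>
    inv_anti₀ hu₀pos (hw_mono _ _ hN.le)
  have hσS : ∀ N ∈ {N : ℕ | Y₀ < N}, 0 < (fun N => (w N)⁻¹) N ∧ (fun N => (w N)⁻¹) N ≤ u₀⁻¹ :=
    fun N hN => ⟨hσpos N hN, hσle N hN⟩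
  have hinj : Set.InjOn (fun N => (w N)⁻¹) {N : ℕ | Y₀ < N} := fun N _ N' _ h =>
    hw_inj (inv_injective h)
  have ht_pos : 0 < 2 / (ρ * u₀) := by positivity
  have hcnt_mono : ∀ {a b : ℕ}, a ≤ b → cnt a ≤ cnt b := fun hab => card_filter_Iic_mono hit hab
  /- one extrapolation step, in logarithmic form -/
  have hkill : ∀ K, Y₀ < K → hit K → ∀ Z : Finset ℕ, (∀ N ∈ Z, Y₀ < N) →
      (∀ N ∈ Z, F (((w N)⁻¹ : ℝ) : ℂ) = 0) →
      (T : ℝ) * Real.log (w K) + Real.log B + Z.card * Real.log (2 / (ρ * u₀)) < 0 →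
      V K = 0 := by
    intro K hK hhK Z hZ1 hZ2 hneg
    have hb := norm_le_at_sample hρ hρr hF hB hB0.le hu₀ (fun N => (w N)⁻¹) {N : ℕ | Y₀ < N}
      hσS hinj Z hZ1 hZ2 hK
    have hwK := hw_pos K (by omega)
    have hVK : |(V K : ℝ)| = w K ^ T * ‖F (((w K)⁻¹ : ℝ) : ℂ)‖ := by
      rw [hFval K hK hhK, norm_mul, norm_pow, Complex.norm_real, Complex.norm_intCast,
        Real.norm_eq_abs, abs_of_pos (hσpos K hK), inv_pow, ← mul_assoc,
        mul_inv_cancel₀ (pow_ne_zero _ hwK.ne'), one_mul]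
    refine int_eq_zero_of_abs_le hwK hB0 ht_pos ?_ hneg
    rw [hVK, mul_assoc]
    exact mul_le_mul_of_nonneg_left hb (by positivity)
  have hlogt : Real.log (2 / (ρ * u₀)) = lρ - lam := by
    rw [hlρ_def, hlam_def, div_mul_eq_div_div, Real.log_div (by positivity) hu₀pos.ne']
  have hlogB' : Real.log B = 4 * Real.log (8 * s₀ * k : ℝ) + 2 * (8 * s₀ * k : ℝ) * lC +
      k * (8 * s₀ ^ 2 * k : ℝ) * lam := by
    rw [hlogB, hTR]
  /- strong induction over the hits beyond `Y₀` -/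
  intro K
  induction K using Nat.strong_induction_on with
  | _ K ih =>
  intro hK hhK
  by_cases hKY : K ≤ Y₀ ^ k
  · by_cases hKE : K ∈ E
    · exact hEzero K hKE
    · refine hkill K hK hhK E (fun N hN => (hEmem N hN).1) (fun N hN => ?_) ?_
      · rw [hFval N (hEmem N hN).1 (hEmem N hN).2.2, hEzero N hN]
        simp
      · -- phase one: `K ≤ Y₀^k`, the `m` Siegel zeros
        have hlogwK : Real.log (w K) ≤ k * lam := by
          have h1 : w K ≤ u₀ ^ k := hwY ▸ hw_mono _ _ hKY
          calc Real.log (w K) ≤ Real.log (u₀ ^ k) := Real.log_le_log (hw_pos K (by omega)) h1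
            _ = k * lam := Real.log_pow u₀ k
        have hlD : Real.log (8 * s₀ * k : ℝ) ≤ 8 * s₀ * k - 1 := Real.log_le_sub_one_of_pos hDpos
        have h1 := phase_one_neg (lρ := lρ) hs₀R hk1R hlD hlC hlam
        have hTlog : (T : ℝ) * Real.log (w K) ≤ 8 * s₀ ^ 2 * k * (k * lam) := by
          rw [hTR]; exact mul_le_mul_of_nonneg_left hlogwK (by positivity)
        rw [hEcard, hlogB', hlogt]
        push_cast
        linarith
  · -- phase two: `K > Y₀^k`, all hits in `(Y₀, K)` are zeros already
    push Not at hKY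
    set Z : Finset ℕ := (Ioc Y₀ (K - 1)).filter hit with hZ_def
    have hZmem : ∀ N ∈ Z, Y₀ < N ∧ N ≤ K - 1 ∧ hit N := fun N hN => by
      simp only [hZ_def, mem_filter, mem_Ioc] at hN
      exact ⟨hN.1.1, hN.1.2, hN.2⟩
    refine hkill K hK hhK Z (fun N hN => (hZmem N hN).1) (fun N hN => ?_) ?_
    · obtain ⟨h1, h2, h3⟩ := hZmem N hN
      rw [hFval N h1 h3, ih N (by omega) h1 h3]
      simp
    · have hK1 : Y₀ ≤ K - 1 := by omega
      have hYK1 : Y₀ ^ k ≤ K - 1 := by omega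
      have hK1pos : 0 < K - 1 := by omega
      have hK2 : 2 ≤ K := by omega
      have hZcardN : Z.card = cnt (K - 1) - n₀ := by
        have := card_filter_Iic_eq_add hit hK1
        simp only [hcnt_def, hZ_def]
        omega
      have hmonoK : n₀ ≤ cnt (K - 1) := hn₀ ▸ hcnt_mono hK1
      have hZcard : (Z.card : ℝ) = cnt (K - 1) - n₀ := by
        rw [hZcardN]; push_cast [hmonoK]; ring
      set ℓ₁ : ℝ := Real.log (w (K - 1)) with hℓ₁_def
      have hZge : (n₀ : ℝ) * ℓ₁ / (2 * lam) - n₀ ≤ Z.card := by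
        have h := hrec (K - 1) hK1
        have h' : (n₀ : ℝ) * ℓ₁ / (2 * lam) ≤ cnt (K - 1) := by
          rw [div_le_iff₀ (by positivity)]
          have : (cnt (K - 1) : ℝ) = ((Iic (K - 1)).filter hit).card := rfl
          rw [this]
          linarith
        rw [hZcard]
        linarith
      have hkℓ : (k : ℝ) * lam ≤ ℓ₁ := by
        have h1 : u₀ ^ k ≤ w (K - 1) := hwY ▸ hw_mono _ _ hYK1
        calc (k : ℝ) * lam = Real.log (u₀ ^ k) := (Real.log_pow u₀ k).symm
          _ ≤ ℓ₁ := Real.log_le_log (by positivity) h1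
      have hℓ : Real.log (w K) ≤ ℓ₁ + 1 := by
        have hwK1 := hw_pos (K - 1) hK1pos
        calc Real.log (w K) ≤ Real.log (2 * w (K - 1)) :=
              Real.log_le_log (hw_pos K (by omega)) (hw_two K hK2)
          _ = Real.log 2 + ℓ₁ := by rw [Real.log_mul (by norm_num) hwK1.ne', hℓ₁_def]
          _ ≤ ℓ₁ + 1 := by
              have := Real.log_le_sub_one_of_pos (show (0 : ℝ) < 2 by norm_num)
              linarith
      have hlD : Real.log (8 * s₀ * k : ℝ) ≤ 8 * s₀ * k := by
        have := Real.log_le_sub_one_of_pos hDpos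
        linarith
      have h2 := phase_two_neg hs₀R hk16R hn₀kR hlD hlC hlρ0 hlam hkℓ hℓ hZge
      rw [hlogB', hlogt, hTR]
      linarith

/-- **Accumulation at the cusp.** If the ray `w` is unbounded, the hits are unbounded, and `F`
vanishes at `σ_K = (w K)⁻¹` for every hit `K > Y₀`, then `F` vanishes frequently on
punctured neighbourhoods of `0`. [folklore] -/
theorem frequently_eq_zero_of_hits {F : ℂ → ℂ} (w : ℕ → ℝ) (hw_pos : ∀ N, 0 < N → 0 < w N)
    (hw_tend : Tendsto w atTop atTop) (hit : ℕ → Prop) {Y₀ : ℕ} (hY₀ : 0 < Y₀)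
    (hunb : ∀ Bd : ℕ, ∃ K, Bd < K ∧ hit K)
    (hzero : ∀ K, Y₀ < K → hit K → F (((w K)⁻¹ : ℝ) : ℂ) = 0) :
    ∃ᶠ z in 𝓝[≠] (0 : ℂ), F z = 0 := by
  rw [Filter.frequently_iff]
  intro U hU
  obtain ⟨δ, hδ, hδU⟩ := Metric.mem_nhdsWithin_iff.mp hU
  obtain ⟨Nδ, hNδ⟩ := (Filter.tendsto_atTop_atTop.mp hw_tend) (δ⁻¹ + 1)
  obtain ⟨K, hK, hhK⟩ := hunb (max Y₀ Nδ)
  have hKY₀ : Y₀ < K := lt_of_le_of_lt (le_max_left _ _) hK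
  have hwK : 0 < w K := hw_pos K (by omega)
  have hσK : (w K)⁻¹ < δ := by
    have h1 : δ⁻¹ < w K := by
      have := hNδ K (le_of_lt (lt_of_le_of_lt (le_max_right _ _) hK))
      linarith
    exact inv_lt_of_inv_lt₀ hδ h1
  refine ⟨(((w K)⁻¹ : ℝ) : ℂ), hδU ⟨?_, ?_⟩, hzero K hKY₀ hhK⟩
  · rw [mem_ball_zero_iff, Complex.norm_real, Real.norm_eq_abs, abs_of_pos (inv_pos.mpr hwK)]
    exact hσK
  · simp only [Set.mem_compl_iff, Set.mem_singleton_iff, Complex.ofReal_eq_zero]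
    exact (inv_pos.mpr hwK).ne'

/-- **Siegel step.** Given `m` sample indices `N ∈ E` with `1 ≤ w N ≤ u`, `(w N)^e = N` and
integers `|L N| ≤ C₀ (w N)^d` (`C₀, u ≥ 1`), and `D² = 2m > 0` unknowns `(i, j) ∈ [0, D)²` with
`e i + d j ≤ T`, there is `a ∈ ℤ^{D×D} ∖ 0` with `∑ a_{ij} Nⁱ (L N)ʲ = 0` for `N ∈ E` and
`|a_{ij}| ≤ D² C₀^D u^T` (Mathlib's Siegel lemma `Int.Matrix.exists_ne_zero_int_vec_norm_le`,
exponent `m/(D² - m) = 1`). [folklore] -/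
theorem exists_cuspAux_coeffs {e d D T : ℕ} {C₀ u : ℝ} (hC₀ : 1 ≤ C₀) (hu : 1 ≤ u)
    (w : ℕ → ℝ) (L : ℕ → ℤ) (E : Finset ℕ) {m : ℕ} (hEcard : E.card = m)
    (hDD : D * D = 2 * m) (hm : 0 < m)
    (hT : ∀ ij : Fin D × Fin D, e * (ij.1 : ℕ) + d * (ij.2 : ℕ) ≤ T)
    (hwE : ∀ N ∈ E, 1 ≤ w N ∧ w N ≤ u ∧ w N ^ e = N ∧ |(L N : ℝ)| ≤ C₀ * w N ^ d) :
    ∃ a : Fin D × Fin D → ℤ, a ≠ 0 ∧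
      (∀ N ∈ E, ∑ ij : Fin D × Fin D, a ij * (N : ℤ) ^ (ij.1 : ℕ) * L N ^ (ij.2 : ℕ) = 0) ∧
      ∀ ij, |(a ij : ℝ)| ≤ (D * D : ℝ) * (C₀ ^ D * u ^ T) := by
  classical
  -- the sup norm on integer matrices, as in Mathlib's Siegel lemma (a `letI`, not an instance)
  letI : SeminormedAddCommGroup (Matrix E (Fin D × Fin D) ℤ) := Matrix.seminormedAddCommGroup
  let Mx : Matrix E (Fin D × Fin D) ℤ :=
    Matrix.of fun N ij => (N.1 : ℤ) ^ (ij.1 : ℕ) * L N.1 ^ (ij.2 : ℕ)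
  have hcardE : Fintype.card E = m := by rw [Fintype.card_coe, hEcard]
  have hcardβ : Fintype.card (Fin D × Fin D) = D * D := by simp
  have hlt : Fintype.card E < Fintype.card (Fin D × Fin D) := by
    rw [hcardE, hcardβ, hDD]; omega
  have hmpos : 0 < Fintype.card E := by rw [hcardE]; exact hm
  obtain ⟨a, ha0, hMa, habound⟩ := Int.Matrix.exists_ne_zero_int_vec_norm_le Mx hlt hmpos
  set H : ℝ := C₀ ^ D * u ^ T with hH_def
  have hH1 : 1 ≤ H := one_le_mul_of_one_le_of_one_le (one_le_pow₀ hC₀) (one_le_pow₀ hu)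
  have hentry : ∀ (N : E) (ij : Fin D × Fin D), ‖Mx N ij‖ ≤ H := by
    rintro ⟨N, hN⟩ ⟨i, j⟩
    obtain ⟨hwN1, hwNu, hwNe, hLN⟩ := hwE N hN
    have hw0 : 0 ≤ w N := zero_le_one.trans hwN1
    rw [Int.norm_eq_abs]
    simp only [Mx, Matrix.of_apply]
    push_cast
    rw [abs_mul, abs_pow, abs_pow, Nat.abs_cast, ← hwNe]
    calc (w N ^ e) ^ (i : ℕ) * |(L N : ℝ)| ^ (j : ℕ)
        ≤ (w N ^ e) ^ (i : ℕ) * (C₀ * w N ^ d) ^ (j : ℕ) := by gcongr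
      _ = C₀ ^ (j : ℕ) * w N ^ (e * i + d * j) := by ring
      _ ≤ C₀ ^ D * u ^ T := by
          refine mul_le_mul (pow_le_pow_right₀ hC₀ j.is_lt.le) ?_ (by positivity)
            (by positivity)
          calc w N ^ (e * i + d * j) ≤ w N ^ T := pow_le_pow_right₀ hwN1 (hT ⟨i, j⟩)
            _ ≤ u ^ T := pow_le_pow_left₀ hw0 hwNu T
  have hMx : ‖Mx‖ ≤ H := (Matrix.norm_le_iff (by positivity)).mpr hentry
  have hmax : max 1 ‖Mx‖ ≤ H := max_le hH1 hMx
  have hexp1 : ((Fintype.card E : ℕ) : ℝ) /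
      ((Fintype.card (Fin D × Fin D) : ℕ) - (Fintype.card E : ℕ)) = 1 := by
    rw [hcardE, hcardβ, hDD]
    have hm0R : (m : ℝ) ≠ 0 := by exact_mod_cast hm.ne'
    push_cast
    field_simp
    ring
  rw [hexp1, Real.rpow_one, hcardβ] at habound
  refine ⟨a, ha0, fun N hN => ?_, fun ij => ?_⟩
  · have h := congrFun hMa ⟨N, hN⟩
    simp only [Matrix.mulVec, dotProduct, Mx, Matrix.of_apply, Pi.zero_apply] at h
    rw [← h]
    exact Finset.sum_congr rfl fun ij _ => by ring
  · have h1 : ‖a ij‖ ≤ ‖a‖ := norm_le_pi_norm a ij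
    rw [Int.norm_eq_abs] at h1
    refine h1.trans (habound.trans ?_)
    push_cast
    exact mul_le_mul_of_nonneg_left hmax (by positivity)

end Literature.NumberTheory.Transcendental

end
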